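import Summits.QuantumFields.YangMills.Theorems.UnitScaleTiltProp7LineIterVsEngineOfTower
import Summits.QuantumFields.YangMills.Theorems.UnitScaleTiltProp7TrueLinIterStructure
import Summits.QuantumFields.YangMills.Theorems.UnitScaleTiltProp7CovIterLambdaBound
import HarnessLib

/-!
# Route `UnitScaleTilt`, crux K1 «MinimiserStabilityRegPr» (stmt-QuantumFields-19200), route-R [RP] curved — THE S2′ KNIT, part A:
# the pointwise structure row `hA` of ✓ p601741 `Prop7CurvedLandauCoercivity` DISCHARGED from the structure identity of ✓ p606268,
# with `E_c := (L^k)^d·(‖T^{(k)}Y(c)‖ + ‖G_k(c) − S_k(c)‖ + ‖S_k(c) − ((L^k)^d)⁻¹Ad_{g_c}A^{U₀}_cY‖)`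

Cell `ym3-torus`, keyed width hand `ym-routeR-w3` (D-0154 (3c); successor session; row (R1) «the S2′ knit» yielded by ★w2-20520 g3, OWNER ACK 26 (4)).
THEOREMS ONLY (0 `def`, 0 `sorry`); `--supports stmt-QuantumFields-19200`, count-neutral.  YM₃ on T³ is a ladder rung (R3), not the Clay problem; nothing here
claims the stub, the crux, d = 4 or the mass gap.

THE POINT.  ✓ p601741 (`sum_normSq_le_curl_sq_of_landau_of_structure_T3`) proves the `L^{−2k}` coercivity of the curved linearised Wilson Hessian on the constrained
Landau slice MODULO three displayed rows: `hA : ‖A^{U₀}_cY‖ ≤ ℓ³(‖Λ(c₊)‖ + ‖Λ(c₋)‖) + E_c`, `hΛ : Σ‖Λ‖² ≤ c_Λ·ℓ·G`, `hE : Σ_cE_c² ≤ c_E·ℓ⁵·ε²·Σ‖Y‖²` (`ℓ = L^k`).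
The structure identity `T^{(k)}Y = G_k + P_{Ū₀^{(k)}}Λ_k` (✓ p606268, `G`∕`Λ` the reduced family and the coarse gauge function at the covariant comb mean) gives
`‖G_k(c)‖ ≤ ‖T^{(k)}Y(c)‖ + ‖Λ_k(c₋)‖ + ‖Λ_k(c₊)‖`; reading the engine penalty in the centre frame, `A^{U₀}_cY = g_c*·((L^k)^d•X_c)·g_c` with
`X_c := ((L^k)^d)⁻¹•(g_c·A^{U₀}_cY·g_c*)` (the letter of ✓ p613443), two triangle inequalities give `hA` with
`E_c := (L^k)^d·(‖T^{(k)}Y(c)‖ + ‖G_k(c) − S(c)‖ + ‖S(c) − X_c‖)` for ANY comparison field `S` (intended: the pure `LINE`-iterate `S_k`, whose two `ℓ²`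
distances are ✓ p608741 and ✓ p613443 — part E of this knit, `…CurvedLandauRowE`).  The d = 3 assembly is `…CurvedLandauKnitT3`.

WHAT IS PROVED (ns `…Theorems.Prop7CurvedLandauRowA`; every recursion family DISPLAYED by its recursion hypotheses, the bricks' convention).
* §0 `exists_trueLinIter_family`, `exists_reduced_family`, `exists_coarseGauge_family` — the families of record exist (`Nat.rec`; the pure `LINE` family is
  ✓ `Prop7LineIterVsEngineOfTower.exists_pureLine_family`).
* §1 `norm_le_norm_conj_su`, `norm_inv_pow_cast`, ★ `norm_engine_le_of_structure` — `hA` with `E_c` as above (any `P`, `SU(N)`, level `k`, (0.4) guards displayed).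
HONEST SCOPE.  Two triangle inequalities over ✓ p606268; nothing of [Balaban1985BackgroundPropagators] is asserted beyond the cited tree theorems.

References: T. Bałaban, CMP 99 (1985) 389–434 [Balaban1985BackgroundPropagators] (Thm 3.11 p.416); CMP 95 (1984) 17–40 [Balaban1984PropagatorsI] ((1.18)–(1.20)
pp.19–20); CMP 102 (1985) 277–309 [Balaban1985Variational] (Prop. 7 p.299).
-/

set_option autoImplicit false

noncomputable section

open scoped BigOperators Matrix.Norms.L2Operator Matrix

namespace Summit.QuantumFields.YangMills.Theorems.Prop7CurvedLandauRowA

open Literature.MathematicalPhysics.QuantumFieldTheory.Balaban1983to89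
open Finset T4Continuum T4ReflectionCone BlockAveraging AveragingRT ExpMeanLog BlockAveragingEMLLinearised BlockAveragingEMLLinearisedBackground
  BlockAveragingEMLProp2 B1RG242Torus
open B15DeterminingSets (embIter)
open B7Prop1Explicit (treeWord)
open B7Eq78Linearization (conjR)
open B10Eq27TorusAxialLog (holT unitsField toUField)
open Summit.QuantumFields.YangMills.Theorems.Prop7TrueLinIterStructure (trueLinIter_structure norm_reduced_le_of_structure)
open Summit.QuantumFields.YangMills.Theorems.Prop7CovIterLambdaBound (norm_conj_su_le)

variable {P : Params} {N : ℕ} [NeZero N]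

/-! ## §0 The recursion families exist (no definitions: `Nat.rec`) -/

/-- The true linearised iterate along the background tower — `Q 0 Y = Y`, `Q (k+1) Y c = T(Ū₀^{(k)})(Q k Y)(c)` — exists as a family (`Nat.rec`).
[cite: Balaban1984PropagatorsI, (1.18)-(1.20) pp.19-20] -/
theorem exists_trueLinIter_family (U₀ : GaugeField P 0 (Matrix.specialUnitaryGroup (Fin N) ℂ)) :
    ∃ Q : (k : ℕ) → (PBond P 0 → Matrix (Fin N) (Fin N) ℂ) → PBond P k → Matrix (Fin N) (Fin N) ℂ, (∀ Y, Q 0 Y = Y) ∧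
      ∀ (k : ℕ) (Y : PBond P 0 → Matrix (Fin N) (Fin N) ℂ) (c : PBond P (k + 1)), Q (k + 1) Y c
        = fderiv ℂ (eml : (Idx P → Matrix (Fin N) (Fin N) ℂ) → Matrix (Fin N) (Fin N) ℂ)
              (fun i => ((loopHol (Averaging.iter (fun i => blockAvg (P := P) (j := i) (expMeanLogSU (n := Fin N))) k U₀) c i :
                Matrix.specialUnitaryGroup (Fin N) ℂ) : Matrix (Fin N) (Fin N) ℂ))
              (fun i => covWalkSum (Averaging.iter (fun i => blockAvg (P := P) (j := i) (expMeanLogSU (n := Fin N))) k U₀) (Q k Y)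
                  (walk (emb c.src) (loopWord P.L c.dir (off i.1) i.2.1 i.2.2))
                * ((loopHol (Averaging.iter (fun i => blockAvg (P := P) (j := i) (expMeanLogSU (n := Fin N))) k U₀) c i :
                  Matrix.specialUnitaryGroup (Fin N) ℂ) : Matrix (Fin N) (Fin N) ℂ))
              * star ((corr (expMeanLogSU (n := Fin N)) (Averaging.iter (fun i => blockAvg (P := P) (j := i) (expMeanLogSU (n := Fin N))) k U₀) c :
                  Matrix.specialUnitaryGroup (Fin N) ℂ) : Matrix (Fin N) (Fin N) ℂ)
            + ((corr (expMeanLogSU (n := Fin N)) (Averaging.iter (fun i => blockAvg (P := P) (j := i) (expMeanLogSU (n := Fin N))) k U₀) c :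
                  Matrix.specialUnitaryGroup (Fin N) ℂ) : Matrix (Fin N) (Fin N) ℂ)
              * covWalkSum (Averaging.iter (fun i => blockAvg (P := P) (j := i) (expMeanLogSU (n := Fin N))) k U₀) (Q k Y)
                  (walk (emb c.src) (List.replicate P.L (c.dir, true)))
              * star ((corr (expMeanLogSU (n := Fin N)) (Averaging.iter (fun i => blockAvg (P := P) (j := i) (expMeanLogSU (n := Fin N))) k U₀) c :
                  Matrix.specialUnitaryGroup (Fin N) ℂ) : Matrix (Fin N) (Fin N) ℂ) := by
  refine ⟨fun k => Nat.rec (motive := fun k => (PBond P 0 → Matrix (Fin N) (Fin N) ℂ) → PBond P k → Matrix (Fin N) (Fin N) ℂ) (fun Y => Y)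
    (fun k Qk => fun Y c =>
      fderiv ℂ (eml : (Idx P → Matrix (Fin N) (Fin N) ℂ) → Matrix (Fin N) (Fin N) ℂ)
          (fun i => ((loopHol (Averaging.iter (fun i => blockAvg (P := P) (j := i) (expMeanLogSU (n := Fin N))) k U₀) c i :
            Matrix.specialUnitaryGroup (Fin N) ℂ) : Matrix (Fin N) (Fin N) ℂ))
          (fun i => covWalkSum (Averaging.iter (fun i => blockAvg (P := P) (j := i) (expMeanLogSU (n := Fin N))) k U₀) (Qk Y)
              (walk (emb c.src) (loopWord P.L c.dir (off i.1) i.2.1 i.2.2))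
            * ((loopHol (Averaging.iter (fun i => blockAvg (P := P) (j := i) (expMeanLogSU (n := Fin N))) k U₀) c i :
              Matrix.specialUnitaryGroup (Fin N) ℂ) : Matrix (Fin N) (Fin N) ℂ))
          * star ((corr (expMeanLogSU (n := Fin N)) (Averaging.iter (fun i => blockAvg (P := P) (j := i) (expMeanLogSU (n := Fin N))) k U₀) c :
              Matrix.specialUnitaryGroup (Fin N) ℂ) : Matrix (Fin N) (Fin N) ℂ)
        + ((corr (expMeanLogSU (n := Fin N)) (Averaging.iter (fun i => blockAvg (P := P) (j := i) (expMeanLogSU (n := Fin N))) k U₀) c :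
              Matrix.specialUnitaryGroup (Fin N) ℂ) : Matrix (Fin N) (Fin N) ℂ)
          * covWalkSum (Averaging.iter (fun i => blockAvg (P := P) (j := i) (expMeanLogSU (n := Fin N))) k U₀) (Qk Y)
              (walk (emb c.src) (List.replicate P.L (c.dir, true)))
          * star ((corr (expMeanLogSU (n := Fin N)) (Averaging.iter (fun i => blockAvg (P := P) (j := i) (expMeanLogSU (n := Fin N))) k U₀) c :
              Matrix.specialUnitaryGroup (Fin N) ℂ) : Matrix (Fin N) (Fin N) ℂ)) k, fun _ => rfl, fun _ _ _ => rfl⟩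

/-- The reduced family at the covariant comb mean — `G 0 = Y`, `G (k+1) c = T(Ū₀^{(k)})(G k)(c) − P_{Ū₀^{(k+1)}}(CM_k(G k))(c)` — exists (`Nat.rec`).
[cite: Balaban1984PropagatorsI, (1.18)-(1.20) pp.19-20] -/
theorem exists_reduced_family (U₀ : GaugeField P 0 (Matrix.specialUnitaryGroup (Fin N) ℂ)) (Y : PBond P 0 → Matrix (Fin N) (Fin N) ℂ) :
    ∃ G : (k : ℕ) → PBond P k → Matrix (Fin N) (Fin N) ℂ, (∀ b, G 0 b = Y b) ∧
      ∀ (k : ℕ) (c : PBond P (k + 1)), G (k + 1) c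
        = (fderiv ℂ (eml : (Idx P → Matrix (Fin N) (Fin N) ℂ) → Matrix (Fin N) (Fin N) ℂ)
              (fun i => ((loopHol (Averaging.iter (fun i => blockAvg (P := P) (j := i) (expMeanLogSU (n := Fin N))) k U₀) c i :
                Matrix.specialUnitaryGroup (Fin N) ℂ) : Matrix (Fin N) (Fin N) ℂ))
              (fun i => covWalkSum (Averaging.iter (fun i => blockAvg (P := P) (j := i) (expMeanLogSU (n := Fin N))) k U₀) (G k)
                  (walk (emb c.src) (loopWord P.L c.dir (off i.1) i.2.1 i.2.2))
                * ((loopHol (Averaging.iter (fun i => blockAvg (P := P) (j := i) (expMeanLogSU (n := Fin N))) k U₀) c i :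
                  Matrix.specialUnitaryGroup (Fin N) ℂ) : Matrix (Fin N) (Fin N) ℂ))
              * star ((corr (expMeanLogSU (n := Fin N)) (Averaging.iter (fun i => blockAvg (P := P) (j := i) (expMeanLogSU (n := Fin N))) k U₀) c :
                  Matrix.specialUnitaryGroup (Fin N) ℂ) : Matrix (Fin N) (Fin N) ℂ)
            + ((corr (expMeanLogSU (n := Fin N)) (Averaging.iter (fun i => blockAvg (P := P) (j := i) (expMeanLogSU (n := Fin N))) k U₀) c :
                  Matrix.specialUnitaryGroup (Fin N) ℂ) : Matrix (Fin N) (Fin N) ℂ)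
              * covWalkSum (Averaging.iter (fun i => blockAvg (P := P) (j := i) (expMeanLogSU (n := Fin N))) k U₀) (G k)
                  (walk (emb c.src) (List.replicate P.L (c.dir, true)))
              * star ((corr (expMeanLogSU (n := Fin N)) (Averaging.iter (fun i => blockAvg (P := P) (j := i) (expMeanLogSU (n := Fin N))) k U₀) c :
                  Matrix.specialUnitaryGroup (Fin N) ℂ) : Matrix (Fin N) (Fin N) ℂ))
          - ((((Fintype.card (Idx P) : ℂ))⁻¹ • ∑ i : Idx P,
                covWalkSum (Averaging.iter (fun i => blockAvg (P := P) (j := i) (expMeanLogSU (n := Fin N))) k U₀) (G k)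
                  (walk (emb c.src) (stairWord i.2.1 (off i.1))))
              - ((Averaging.iter (fun i => blockAvg (P := P) (j := i) (expMeanLogSU (n := Fin N))) (k + 1) U₀ c : Matrix.specialUnitaryGroup (Fin N) ℂ) :
                  Matrix (Fin N) (Fin N) ℂ)
                * (((Fintype.card (Idx P) : ℂ))⁻¹ • ∑ i : Idx P,
                    covWalkSum (Averaging.iter (fun i => blockAvg (P := P) (j := i) (expMeanLogSU (n := Fin N))) k U₀) (G k)
                      (walk (emb c.tgt) (stairWord i.2.1 (off i.1))))
                * star ((Averaging.iter (fun i => blockAvg (P := P) (j := i) (expMeanLogSU (n := Fin N))) (k + 1) U₀ c :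
                  Matrix.specialUnitaryGroup (Fin N) ℂ) : Matrix (Fin N) (Fin N) ℂ)) := by
  refine ⟨fun k => Nat.rec (motive := fun k => PBond P k → Matrix (Fin N) (Fin N) ℂ) Y
    (fun k Gk => fun c =>
      (fderiv ℂ (eml : (Idx P → Matrix (Fin N) (Fin N) ℂ) → Matrix (Fin N) (Fin N) ℂ)
          (fun i => ((loopHol (Averaging.iter (fun i => blockAvg (P := P) (j := i) (expMeanLogSU (n := Fin N))) k U₀) c i :
            Matrix.specialUnitaryGroup (Fin N) ℂ) : Matrix (Fin N) (Fin N) ℂ))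
          (fun i => covWalkSum (Averaging.iter (fun i => blockAvg (P := P) (j := i) (expMeanLogSU (n := Fin N))) k U₀) Gk
              (walk (emb c.src) (loopWord P.L c.dir (off i.1) i.2.1 i.2.2))
            * ((loopHol (Averaging.iter (fun i => blockAvg (P := P) (j := i) (expMeanLogSU (n := Fin N))) k U₀) c i :
              Matrix.specialUnitaryGroup (Fin N) ℂ) : Matrix (Fin N) (Fin N) ℂ))
          * star ((corr (expMeanLogSU (n := Fin N)) (Averaging.iter (fun i => blockAvg (P := P) (j := i) (expMeanLogSU (n := Fin N))) k U₀) c :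
              Matrix.specialUnitaryGroup (Fin N) ℂ) : Matrix (Fin N) (Fin N) ℂ)
        + ((corr (expMeanLogSU (n := Fin N)) (Averaging.iter (fun i => blockAvg (P := P) (j := i) (expMeanLogSU (n := Fin N))) k U₀) c :
              Matrix.specialUnitaryGroup (Fin N) ℂ) : Matrix (Fin N) (Fin N) ℂ)
          * covWalkSum (Averaging.iter (fun i => blockAvg (P := P) (j := i) (expMeanLogSU (n := Fin N))) k U₀) Gk
              (walk (emb c.src) (List.replicate P.L (c.dir, true)))
          * star ((corr (expMeanLogSU (n := Fin N)) (Averaging.iter (fun i => blockAvg (P := P) (j := i) (expMeanLogSU (n := Fin N))) k U₀) c :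
              Matrix.specialUnitaryGroup (Fin N) ℂ) : Matrix (Fin N) (Fin N) ℂ))
      - ((((Fintype.card (Idx P) : ℂ))⁻¹ • ∑ i : Idx P,
            covWalkSum (Averaging.iter (fun i => blockAvg (P := P) (j := i) (expMeanLogSU (n := Fin N))) k U₀) Gk
              (walk (emb c.src) (stairWord i.2.1 (off i.1))))
          - ((Averaging.iter (fun i => blockAvg (P := P) (j := i) (expMeanLogSU (n := Fin N))) (k + 1) U₀ c : Matrix.specialUnitaryGroup (Fin N) ℂ) :
              Matrix (Fin N) (Fin N) ℂ)
            * (((Fintype.card (Idx P) : ℂ))⁻¹ • ∑ i : Idx P,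
                covWalkSum (Averaging.iter (fun i => blockAvg (P := P) (j := i) (expMeanLogSU (n := Fin N))) k U₀) Gk
                  (walk (emb c.tgt) (stairWord i.2.1 (off i.1))))
            * star ((Averaging.iter (fun i => blockAvg (P := P) (j := i) (expMeanLogSU (n := Fin N))) (k + 1) U₀ c :
              Matrix.specialUnitaryGroup (Fin N) ℂ) : Matrix (Fin N) (Fin N) ℂ))) k, fun _ => rfl, fun _ _ => rfl⟩

/-- The coarse gauge function of record — `Λ 0 = 0`, `Λ (k+1) z = CM_k(G k)(z) + Λ k (emb z)` — exists for every reduced family `G` (`Nat.rec`).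
[cite: Balaban1984PropagatorsI, (1.18)-(1.20) pp.19-20] -/
theorem exists_coarseGauge_family (U₀ : GaugeField P 0 (Matrix.specialUnitaryGroup (Fin N) ℂ)) (G : (k : ℕ) → PBond P k → Matrix (Fin N) (Fin N) ℂ) :
    ∃ Λ : (k : ℕ) → Site P k → Matrix (Fin N) (Fin N) ℂ, (∀ y, Λ 0 y = 0) ∧
      ∀ (k : ℕ) (z : Site P (k + 1)), Λ (k + 1) z
        = ((Fintype.card (Idx P) : ℂ))⁻¹ • ∑ i : Idx P,
            covWalkSum (Averaging.iter (fun i => blockAvg (P := P) (j := i) (expMeanLogSU (n := Fin N))) k U₀) (G k)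
              (walk (emb z) (stairWord i.2.1 (off i.1)))
          + Λ k (emb z) := by
  refine ⟨fun k => Nat.rec (motive := fun k => Site P k → Matrix (Fin N) (Fin N) ℂ) (fun _ => 0)
    (fun k Λk => fun z =>
      ((Fintype.card (Idx P) : ℂ))⁻¹ • ∑ i : Idx P,
          covWalkSum (Averaging.iter (fun i => blockAvg (P := P) (j := i) (expMeanLogSU (n := Fin N))) k U₀) (G k)
            (walk (emb z) (stairWord i.2.1 (off i.1)))
        + Λk (emb z)) k, fun _ => rfl, fun _ _ => rfl⟩

/-! ## §1 ★ The pointwise row `hA`: engine penalty ≤ `ℓ^d`·(coarse gradient) + `E_c` -/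

/-- Conjugating BACK by a special-unitary matrix: `‖X‖ ≤ ‖u·X·u*‖` (equality in fact; `X = u*·(uXu*)·u`). [folklore] -/
theorem norm_le_norm_conj_su (u : Matrix.specialUnitaryGroup (Fin N) ℂ) (X : Matrix (Fin N) (Fin N) ℂ) :
    ‖X‖ ≤ ‖(u : Matrix (Fin N) (Fin N) ℂ) * X * star (u : Matrix (Fin N) (Fin N) ℂ)‖ := by
  have hu : star (u : Matrix (Fin N) (Fin N) ℂ) * (u : Matrix (Fin N) (Fin N) ℂ) = 1 :=
    Matrix.mem_unitaryGroup_iff'.1 (Matrix.mem_specialUnitaryGroup_iff.1 u.2).1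
  have h := norm_conj_su_le (star u) ((u : Matrix (Fin N) (Fin N) ℂ) * X * star (u : Matrix (Fin N) (Fin N) ℂ))
  have hcoe : ((star u : Matrix.specialUnitaryGroup (Fin N) ℂ) : Matrix (Fin N) (Fin N) ℂ) = star (u : Matrix (Fin N) (Fin N) ℂ) := rfl
  rw [hcoe, star_star] at h
  have hX : star (u : Matrix (Fin N) (Fin N) ℂ) * ((u : Matrix (Fin N) (Fin N) ℂ) * X * star (u : Matrix (Fin N) (Fin N) ℂ))
      * (u : Matrix (Fin N) (Fin N) ℂ) = X := by
    calc _ = (star (u : Matrix (Fin N) (Fin N) ℂ) * (u : Matrix (Fin N) (Fin N) ℂ)) * X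
          * (star (u : Matrix (Fin N) (Fin N) ℂ) * (u : Matrix (Fin N) (Fin N) ℂ)) := by noncomm_ring
      _ = X := by rw [hu, one_mul, mul_one]
  rw [hX] at h
  exact h

/-- The `ℂ`-scalar `((L^k)^d)⁻¹` has norm `((L^k)^d)⁻¹`. [folklore] -/
theorem norm_inv_pow_cast (k : ℕ) : ‖((((P.L : ℂ) ^ k) ^ P.d)⁻¹ : ℂ)‖ = (((P.L : ℝ) ^ k) ^ P.d)⁻¹ := by
  rw [norm_inv, norm_pow, norm_pow, Complex.norm_natCast]

/-- ★ **THE ROW `hA` OF S2′ FROM THE STRUCTURE IDENTITY.**  Background `U₀ ∈ SU(N)`, tower `Ū₀^{(j)}`, the (0.4) guards `dist1(W^{(j)}_i(c)) < δ_N` (`j < k`)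
displayed; `Q` the true linearised iterate, `G`∕`Λ` the reduced family and the coarse gauge function of record (covariant comb mean), `S` ANY level-`k` field
(intended: the pure `LINE`-iterate) and `X_c := ((L^k)^d)⁻¹•(g_c·A^{U₀}_cY·g_c*)` the engine functional read in the centre frame (✓ p613443).  Then for every
coarse bond `c`:  `‖A^{U₀}_cY‖ ≤ (L^k)^d·(‖Λ_k(c₊)‖ + ‖Λ_k(c₋)‖) + (L^k)^d·(‖Q k Y c‖ + ‖G_k(c) − S(c)‖ + ‖S(c) − X_c‖)` — the `hA` row of ✓ p601741 with
`E_c := (L^k)^d·(…)`. [cite: Balaban1985BackgroundPropagators, Thm 3.11 p.416; Balaban1984PropagatorsI, (1.18)-(1.20) pp.19-20] -/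
theorem norm_engine_le_of_structure (U₀ : GaugeField P 0 (Matrix.specialUnitaryGroup (Fin N) ℂ))
    (Q : (k : ℕ) → (PBond P 0 → Matrix (Fin N) (Fin N) ℂ) → PBond P k → Matrix (Fin N) (Fin N) ℂ) (hQ0 : ∀ Y, Q 0 Y = Y)
    (hQs : ∀ (k : ℕ) (Y : PBond P 0 → Matrix (Fin N) (Fin N) ℂ) (c : PBond P (k + 1)), Q (k + 1) Y c
      = fderiv ℂ (eml : (Idx P → Matrix (Fin N) (Fin N) ℂ) → Matrix (Fin N) (Fin N) ℂ)
            (fun i => ((loopHol (Averaging.iter (fun i => blockAvg (P := P) (j := i) (expMeanLogSU (n := Fin N))) k U₀) c i :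
              Matrix.specialUnitaryGroup (Fin N) ℂ) : Matrix (Fin N) (Fin N) ℂ))
            (fun i => covWalkSum (Averaging.iter (fun i => blockAvg (P := P) (j := i) (expMeanLogSU (n := Fin N))) k U₀) (Q k Y)
                (walk (emb c.src) (loopWord P.L c.dir (off i.1) i.2.1 i.2.2))
              * ((loopHol (Averaging.iter (fun i => blockAvg (P := P) (j := i) (expMeanLogSU (n := Fin N))) k U₀) c i :
                Matrix.specialUnitaryGroup (Fin N) ℂ) : Matrix (Fin N) (Fin N) ℂ))
            * star ((corr (expMeanLogSU (n := Fin N)) (Averaging.iter (fun i => blockAvg (P := P) (j := i) (expMeanLogSU (n := Fin N))) k U₀) c :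
                Matrix.specialUnitaryGroup (Fin N) ℂ) : Matrix (Fin N) (Fin N) ℂ)
          + ((corr (expMeanLogSU (n := Fin N)) (Averaging.iter (fun i => blockAvg (P := P) (j := i) (expMeanLogSU (n := Fin N))) k U₀) c :
                Matrix.specialUnitaryGroup (Fin N) ℂ) : Matrix (Fin N) (Fin N) ℂ)
            * covWalkSum (Averaging.iter (fun i => blockAvg (P := P) (j := i) (expMeanLogSU (n := Fin N))) k U₀) (Q k Y)
                (walk (emb c.src) (List.replicate P.L (c.dir, true)))
            * star ((corr (expMeanLogSU (n := Fin N)) (Averaging.iter (fun i => blockAvg (P := P) (j := i) (expMeanLogSU (n := Fin N))) k U₀) c :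
                Matrix.specialUnitaryGroup (Fin N) ℂ) : Matrix (Fin N) (Fin N) ℂ))
    (Y : PBond P 0 → Matrix (Fin N) (Fin N) ℂ)
    (G : (k : ℕ) → PBond P k → Matrix (Fin N) (Fin N) ℂ) (Λ : (k : ℕ) → Site P k → Matrix (Fin N) (Fin N) ℂ)
    (hG0 : ∀ b, G 0 b = Y b) (hΛ0 : ∀ x, Λ 0 x = 0)
    (hΛs : ∀ (k : ℕ) (z : Site P (k + 1)), Λ (k + 1) z
      = ((Fintype.card (Idx P) : ℂ))⁻¹ • ∑ i : Idx P,
          covWalkSum (Averaging.iter (fun i => blockAvg (P := P) (j := i) (expMeanLogSU (n := Fin N))) k U₀) (G k)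
            (walk (emb z) (stairWord i.2.1 (off i.1)))
        + Λ k (emb z))
    (hGs : ∀ (k : ℕ) (c : PBond P (k + 1)), G (k + 1) c
      = (fderiv ℂ (eml : (Idx P → Matrix (Fin N) (Fin N) ℂ) → Matrix (Fin N) (Fin N) ℂ)
            (fun i => ((loopHol (Averaging.iter (fun i => blockAvg (P := P) (j := i) (expMeanLogSU (n := Fin N))) k U₀) c i :
              Matrix.specialUnitaryGroup (Fin N) ℂ) : Matrix (Fin N) (Fin N) ℂ))
            (fun i => covWalkSum (Averaging.iter (fun i => blockAvg (P := P) (j := i) (expMeanLogSU (n := Fin N))) k U₀) (G k)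
                (walk (emb c.src) (loopWord P.L c.dir (off i.1) i.2.1 i.2.2))
              * ((loopHol (Averaging.iter (fun i => blockAvg (P := P) (j := i) (expMeanLogSU (n := Fin N))) k U₀) c i :
                Matrix.specialUnitaryGroup (Fin N) ℂ) : Matrix (Fin N) (Fin N) ℂ))
            * star ((corr (expMeanLogSU (n := Fin N)) (Averaging.iter (fun i => blockAvg (P := P) (j := i) (expMeanLogSU (n := Fin N))) k U₀) c :
                Matrix.specialUnitaryGroup (Fin N) ℂ) : Matrix (Fin N) (Fin N) ℂ)
          + ((corr (expMeanLogSU (n := Fin N)) (Averaging.iter (fun i => blockAvg (P := P) (j := i) (expMeanLogSU (n := Fin N))) k U₀) c :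
                Matrix.specialUnitaryGroup (Fin N) ℂ) : Matrix (Fin N) (Fin N) ℂ)
            * covWalkSum (Averaging.iter (fun i => blockAvg (P := P) (j := i) (expMeanLogSU (n := Fin N))) k U₀) (G k)
                (walk (emb c.src) (List.replicate P.L (c.dir, true)))
            * star ((corr (expMeanLogSU (n := Fin N)) (Averaging.iter (fun i => blockAvg (P := P) (j := i) (expMeanLogSU (n := Fin N))) k U₀) c :
                Matrix.specialUnitaryGroup (Fin N) ℂ) : Matrix (Fin N) (Fin N) ℂ))
        - ((((Fintype.card (Idx P) : ℂ))⁻¹ • ∑ i : Idx P,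
              covWalkSum (Averaging.iter (fun i => blockAvg (P := P) (j := i) (expMeanLogSU (n := Fin N))) k U₀) (G k)
                (walk (emb c.src) (stairWord i.2.1 (off i.1))))
            - ((Averaging.iter (fun i => blockAvg (P := P) (j := i) (expMeanLogSU (n := Fin N))) (k + 1) U₀ c : Matrix.specialUnitaryGroup (Fin N) ℂ) :
                Matrix (Fin N) (Fin N) ℂ)
              * (((Fintype.card (Idx P) : ℂ))⁻¹ • ∑ i : Idx P,
                  covWalkSum (Averaging.iter (fun i => blockAvg (P := P) (j := i) (expMeanLogSU (n := Fin N))) k U₀) (G k)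
                    (walk (emb c.tgt) (stairWord i.2.1 (off i.1))))
              * star ((Averaging.iter (fun i => blockAvg (P := P) (j := i) (expMeanLogSU (n := Fin N))) (k + 1) U₀ c :
                Matrix.specialUnitaryGroup (Fin N) ℂ) : Matrix (Fin N) (Fin N) ℂ)))
    {k : ℕ} (hg : ∀ j < k, ∀ (c : PBond P (j + 1)) (i : Idx P),
        dist1 (loopHol (Averaging.iter (fun i => blockAvg (P := P) (j := i) (expMeanLogSU (n := Fin N))) j U₀) c i) < deltaSU (Fin N))
    (S : PBond P k → Matrix (Fin N) (Fin N) ℂ) (c : PBond P k) :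
    ‖∑ r : Fin P.d → Fin (P.L ^ k), ∑ s ∈ Finset.range (P.L ^ k),
        conjR (holT (unitsField (toUField U₀)) (Site.fibreSite 0 k c.src fun _ => ⟨0, pow_pos P.L_pos k⟩) (treeWord fun ν => ((r ν : ℕ) : ℤ))
            * holT (unitsField (toUField U₀)) (Site.fibreSite 0 k c.src r) (List.replicate s (c.dir, true)))
          (Y ⟨(fun z : Site P 0 => z.shift c.dir)^[s] (Site.fibreSite 0 k c.src r), c.dir⟩)‖
      ≤ ((P.L : ℝ) ^ k) ^ P.d * (‖Λ k c.tgt‖ + ‖Λ k c.src‖)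
        + ((P.L : ℝ) ^ k) ^ P.d * (‖Q k Y c‖ + ‖G k c - S c‖
          + ‖S c - (((P.L : ℂ) ^ k) ^ P.d)⁻¹ •
              (((holAt U₀ (walk (embIter k c.src) (treeWord fun _ : Fin P.d => -(((P.L ^ k - 1) / 2 : ℕ) : ℤ))) :
                  Matrix.specialUnitaryGroup (Fin N) ℂ) : Matrix (Fin N) (Fin N) ℂ)
                * (∑ r : Fin P.d → Fin (P.L ^ k), ∑ s ∈ Finset.range (P.L ^ k),
                    conjR (holT (unitsField (toUField U₀)) (Site.fibreSite 0 k c.src fun _ => ⟨0, pow_pos P.L_pos k⟩) (treeWord fun ν => ((r ν : ℕ) : ℤ))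
                        * holT (unitsField (toUField U₀)) (Site.fibreSite 0 k c.src r) (List.replicate s (c.dir, true)))
                      (Y ⟨(fun z : Site P 0 => z.shift c.dir)^[s] (Site.fibreSite 0 k c.src r), c.dir⟩))
                * star (((holAt U₀ (walk (embIter k c.src) (treeWord fun _ : Fin P.d => -(((P.L ^ k - 1) / 2 : ℕ) : ℤ))) :
                    Matrix.specialUnitaryGroup (Fin N) ℂ) : Matrix (Fin N) (Fin N) ℂ)))‖) := by
  -- letters
  set ℓd : ℝ := ((P.L : ℝ) ^ k) ^ P.d with hℓd
  have hLpos : (0 : ℝ) < (P.L : ℝ) := by exact_mod_cast P.L_pos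
  have hℓd0 : 0 < ℓd := by positivity
  set A := ∑ r : Fin P.d → Fin (P.L ^ k), ∑ s ∈ Finset.range (P.L ^ k),
        conjR (holT (unitsField (toUField U₀)) (Site.fibreSite 0 k c.src fun _ => ⟨0, pow_pos P.L_pos k⟩) (treeWord fun ν => ((r ν : ℕ) : ℤ))
            * holT (unitsField (toUField U₀)) (Site.fibreSite 0 k c.src r) (List.replicate s (c.dir, true)))
          (Y ⟨(fun z : Site P 0 => z.shift c.dir)^[s] (Site.fibreSite 0 k c.src r), c.dir⟩) with hA
  set g : Matrix.specialUnitaryGroup (Fin N) ℂ :=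
    holAt U₀ (walk (embIter k c.src) (treeWord fun _ : Fin P.d => -(((P.L ^ k - 1) / 2 : ℕ) : ℤ))) with hg'
  set X : Matrix (Fin N) (Fin N) ℂ := (((P.L : ℂ) ^ k) ^ P.d)⁻¹ • ((g : Matrix (Fin N) (Fin N) ℂ) * A * star (g : Matrix (Fin N) (Fin N) ℂ)) with hX
  -- (1) `‖A‖ ≤ ‖gAg*‖ = ℓ^d‖X‖`
  have h1 : ‖A‖ ≤ ℓd * ‖X‖ := by
    have hsc : (((P.L : ℂ) ^ k) ^ P.d) ≠ 0 := by
      have : (P.L : ℂ) ≠ 0 := by exact_mod_cast P.L_pos.ne'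
      exact pow_ne_zero _ (pow_ne_zero _ this)
    have hgAg : (g : Matrix (Fin N) (Fin N) ℂ) * A * star (g : Matrix (Fin N) (Fin N) ℂ) = (((P.L : ℂ) ^ k) ^ P.d) • X := by
      rw [hX, smul_inv_smul₀ hsc]
    calc ‖A‖ ≤ ‖(g : Matrix (Fin N) (Fin N) ℂ) * A * star (g : Matrix (Fin N) (Fin N) ℂ)‖ := norm_le_norm_conj_su g A
      _ = ℓd * ‖X‖ := by
          rw [hgAg, norm_smul, norm_pow, norm_pow, Complex.norm_natCast]
  -- (2) `‖X‖ ≤ ‖G k c‖ + ‖G k c − S c‖ + ‖S c − X‖`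
  have h2 : ‖X‖ ≤ ‖G k c‖ + ‖G k c - S c‖ + ‖S c - X‖ := by
    have e : X = G k c - (G k c - S c) - (S c - X) := by abel
    calc ‖X‖ = ‖G k c - (G k c - S c) - (S c - X)‖ := by rw [← e]
      _ ≤ ‖G k c - (G k c - S c)‖ + ‖S c - X‖ := norm_sub_le _ _
      _ ≤ ‖G k c‖ + ‖G k c - S c‖ + ‖S c - X‖ := add_le_add (norm_sub_le _ _) le_rfl
  -- (3) `‖G k c‖ ≤ ‖Q k Y c‖ + ‖Λ k c₋‖ + ‖Λ k c₊‖` (structure identity)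
  have h3 : ‖G k c‖ ≤ ‖Q k Y c‖ + ‖Λ k c.src‖ + ‖Λ k c.tgt‖ :=
    norm_reduced_le_of_structure _ (Λ k) c
      (trueLinIter_structure U₀ Q hQ0 hQs Y
        (fun k Gk z => ((Fintype.card (Idx P) : ℂ))⁻¹ • ∑ i : Idx P,
          covWalkSum (Averaging.iter (fun i => blockAvg (P := P) (j := i) (expMeanLogSU (n := Fin N))) k U₀) Gk
            (walk (emb z) (stairWord i.2.1 (off i.1))))
        G Λ hG0 hΛ0 hΛs hGs k hg c)
  -- assemble
  have hn1 := norm_nonneg (Q k Y c)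
  have hn2 := norm_nonneg (G k c - S c)
  have hn3 := norm_nonneg (S c - X)
  have hn4 := norm_nonneg (Λ k c.src)
  have hn5 := norm_nonneg (Λ k c.tgt)
  nlinarith [h1, h2, h3, hℓd0.le]



end Summit.QuantumFields.YangMills.Theorems.Prop7CurvedLandauRowA

end
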